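import Summits.CriticalPhenomena.PercolationContinuityZ3.Theorems.PercNearOneGluingNoHeavyLowerTailSuperTerminalP3LamDvec
import HarnessLib

/-!
# `P3_λ` (`λ ≥ 8/5`) on a finite weighted graph follows from `P3_λ` on its `{s,a,b,c}`-pieces (graph-level assembly of THEOREM C′)

Support file for crux `stmt-CriticalPhenomena-4575` (`NoHeavyLowerTail`), seat `prim-l12-p1` gen 32 (`--supports stmt-CriticalPhenomena-4575`);
part 2 of 2 of the assembly of THEOREM C′ (part 1: `…SuperTerminalP3LamDvec`); companion of `…SuperTerminalP3HalfGluing` (THEOREM C, `λ = 2`).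
No definitions, no sorries, standard axioms.

MAIN THEOREM (`p3lam_of_pieces`).  For `λ ≥ 8/5`, pairwise distinct `s a b c`, and a splitting `part : V → ι` of `w` along `T₄ = {s,a,b,c}`
(non-terminal pairs across labels have weight `0`): **if the reverse-Harris row `P3_λ` — `μ(F)·μ(c ↔ {s,a,b}) ≤ λ·μ(F ∩ c ↔ {s,a,b})`,
`F = {s↔a}∩{s↮b}` — holds for every piece as a weighted graph of its own (`wᵢ := w·1_{pairs of piece i}`), then it holds for `w`.**
So for every `λ ≥ 8/5` a counterexample to `P3_λ` with the fewest internal vertices is `{s,a,b,c}`-prime.  (At the conjectured sharp constant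
`λ = 3/2` this assembly is not available: cell-level stability fails for abstract laws under every catalogued law, memo
`FROM-prim-l12-p1-g31-P3-SHARP-ROW-STABILITY.md`; `8/5` is the exact threshold of the cell-level method, `SuperTerminalP3LamStable.p3lam_stable_sharp`.)

PROOF.  Induction over sets `S` of pieces on the vector `D(w₀)·∏_{i∈S} D(wᵢ)`, which is the down-set vector of the partial union `w_S`
(`SuperTerminalP3LamDvec.real_partLE_partialUnion`) and therefore satisfies the order relations and the face inequality (`core_of_weight`,
`face_of_weight`); the step is `dvec_p3lam_mul`; the terminal piece `w₀` is treated by the same induction pair by pair (`rowLam_terminal`);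
at `S = univ` the vector is `D(w)` by the splitting formula [BeicheltTittmann2012, Thm. 7.5] and `rowLam_iff` translates back.
-/

namespace Summit.CriticalPhenomena.PercolationContinuityZ3.Theorems.SuperTerminalP3LamGluing

open MeasureTheory Set
open Literature.Probability.Percolation Literature.Probability.Percolation.PartitionGluing
open Literature.Probability.LatticeModels (prodBernoulli)
open SuperTerminalDownsets SuperTerminalDownsetEvents SuperTerminalP3LamDvec
open scoped Classical

variable {V : Type*} [Fintype V]

/-- The row `P3_λ` in down-set coordinates: `μ(F)(1 − γ) ≤ λ·μ(F ∩ c↔T)` (as in `…SuperTerminalP3LamDvec`).  Local notation only. -/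
local notation "RowLam[" lam ";" x0 "," x1 "," x2 "," x3 "," x4 "," x5 "," x6 "," x7 "]" =>
  (((x2 - x3 + x4 - x5 - x6 - x1 + 2 * x0) * (1 - x7) ≤ lam * (x2 - x3 + x4 - x5 - x6 - 2 * x1 + 3 * x0)) : Prop)

/-! ## The terminal piece and the assembly -/

section Pieces
variable {s a b c : V}

/-- **The terminal piece satisfies `P3_λ` (`λ ≥ 8/5`)**: for `w₀ := w·1_{pairs of T₄}` the row holds in down-set coordinates — induction over the
terminal pairs with `dvec_p3lam_mul`, each one-pair graph satisfying the row trivially (`real_F_mul_conn_single`) and each partial graph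
satisfying the face inequality (`face_of_weight`). [this work] -/
theorem rowLam_terminal (w : Sym2 V → unitInterval) (hd : s ≠ a ∧ s ≠ b ∧ s ≠ c ∧ a ≠ b ∧ a ≠ c ∧ b ≠ c) {lam : ℝ} (hlam : 8 / 5 ≤ lam) :
    RowLam[lam; (prodBernoulli fun e => if e ∈ ({s, a, b, c} : Finset V).sym2 then w e else 0).real
        ((openConn s a)ᶜ ∩ (openConn s b)ᶜ ∩ (openConn s c)ᶜ ∩ (openConn a b)ᶜ ∩ (openConn a c)ᶜ ∩ (openConn b c)ᶜ),
      (prodBernoulli fun e => if e ∈ ({s, a, b, c} : Finset V).sym2 then w e else 0).real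
        ((openConn s b)ᶜ ∩ (openConn s c)ᶜ ∩ (openConn a b)ᶜ ∩ (openConn a c)ᶜ ∩ (openConn b c)ᶜ),
      (prodBernoulli fun e => if e ∈ ({s, a, b, c} : Finset V).sym2 then w e else 0).real
        ((openConn s b)ᶜ ∩ (openConn s c)ᶜ ∩ (openConn a b)ᶜ ∩ (openConn a c)ᶜ),
      (prodBernoulli fun e => if e ∈ ({s, a, b, c} : Finset V).sym2 then w e else 0).real
        ((openConn s a)ᶜ ∩ (openConn s b)ᶜ ∩ (openConn s c)ᶜ ∩ (openConn a b)ᶜ ∩ (openConn a c)ᶜ),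
      (prodBernoulli fun e => if e ∈ ({s, a, b, c} : Finset V).sym2 then w e else 0).real
        ((openConn s b)ᶜ ∩ (openConn a b)ᶜ ∩ (openConn b c)ᶜ),
      (prodBernoulli fun e => if e ∈ ({s, a, b, c} : Finset V).sym2 then w e else 0).real
        ((openConn s a)ᶜ ∩ (openConn s b)ᶜ ∩ (openConn a b)ᶜ ∩ (openConn a c)ᶜ ∩ (openConn b c)ᶜ),
      (prodBernoulli fun e => if e ∈ ({s, a, b, c} : Finset V).sym2 then w e else 0).real
        ((openConn s a)ᶜ ∩ (openConn s b)ᶜ ∩ (openConn s c)ᶜ ∩ (openConn a b)ᶜ ∩ (openConn b c)ᶜ),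
      (prodBernoulli fun e => if e ∈ ({s, a, b, c} : Finset V).sym2 then w e else 0).real
        ((openConn c s)ᶜ ∩ (openConn c a)ᶜ ∩ (openConn c b)ᶜ)] := by
  suffices H : ∀ P : Finset (Sym2 V), P ⊆ ({s, a, b, c} : Finset V).sym2 →
      RowLam[lam; (prodBernoulli fun e => if e ∈ P then w e else 0).real
          ((openConn s a)ᶜ ∩ (openConn s b)ᶜ ∩ (openConn s c)ᶜ ∩ (openConn a b)ᶜ ∩ (openConn a c)ᶜ ∩ (openConn b c)ᶜ),
        (prodBernoulli fun e => if e ∈ P then w e else 0).real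
          ((openConn s b)ᶜ ∩ (openConn s c)ᶜ ∩ (openConn a b)ᶜ ∩ (openConn a c)ᶜ ∩ (openConn b c)ᶜ),
        (prodBernoulli fun e => if e ∈ P then w e else 0).real ((openConn s b)ᶜ ∩ (openConn s c)ᶜ ∩ (openConn a b)ᶜ ∩ (openConn a c)ᶜ),
        (prodBernoulli fun e => if e ∈ P then w e else 0).real
          ((openConn s a)ᶜ ∩ (openConn s b)ᶜ ∩ (openConn s c)ᶜ ∩ (openConn a b)ᶜ ∩ (openConn a c)ᶜ),
        (prodBernoulli fun e => if e ∈ P then w e else 0).real ((openConn s b)ᶜ ∩ (openConn a b)ᶜ ∩ (openConn b c)ᶜ),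
        (prodBernoulli fun e => if e ∈ P then w e else 0).real
          ((openConn s a)ᶜ ∩ (openConn s b)ᶜ ∩ (openConn a b)ᶜ ∩ (openConn a c)ᶜ ∩ (openConn b c)ᶜ),
        (prodBernoulli fun e => if e ∈ P then w e else 0).real
          ((openConn s a)ᶜ ∩ (openConn s b)ᶜ ∩ (openConn s c)ᶜ ∩ (openConn a b)ᶜ ∩ (openConn b c)ᶜ),
        (prodBernoulli fun e => if e ∈ P then w e else 0).real ((openConn c s)ᶜ ∩ (openConn c a)ᶜ ∩ (openConn c b)ᶜ)] from
    H _ (Finset.Subset.refl _)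
  intro P
  induction P using Finset.induction_on with
  | empty =>
    intro _
    have hz : (fun e : Sym2 V => if e ∈ (∅ : Finset (Sym2 V)) then w e else 0) = fun _ => (0 : unitInterval) := by
      funext e; simp
    rw [hz, ← partLE_blk0 hd, ← partLE_blk1 hd, ← partLE_blk2 hd, ← partLE_blk3 hd, ← partLE_blk4 hd, ← partLE_blk5 hd,
      ← partLE_blk6 hd, ← partLE_blk7 hd]
    simp only [real_partLE_zero]
    norm_num
  | @insert e P heP ih =>
    intro hsub
    have heT : e ∈ ({s, a, b, c} : Finset V).sym2 := hsub (Finset.mem_insert_self e P)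
    have hPT : P ⊆ ({s, a, b, c} : Finset V).sym2 := fun x hx => hsub (Finset.mem_insert_of_mem hx)
    have G1 := ih hPT
    have C1 := core_of_weight (fun e' : Sym2 V => if e' ∈ P then w e' else 0) s a b c
    have F1 := face_of_weight (fun e' : Sym2 V => if e' ∈ P then w e' else 0) hd
    have C2 := core_of_weight (fun e' : Sym2 V => if e' = e then w e' else 0) s a b c
    have F2 := face_of_weight (fun e' : Sym2 V => if e' = e then w e' else 0) hd
    have G2 := (rowLam_iff (fun e' : Sym2 V => if e' = e then w e' else 0) lam s a b c).1 (by
      rw [real_F_mul_conn_single w hd e]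
      exact mul_nonneg (by linarith) measureReal_nonneg)
    -- the three weights are terminal-only and `1 − w·1_{P ∪ {e}} = (1 − w·1_P)(1 − w·1_{e})`
    have nt : ∀ x y : V, x ∉ ({s, a, b, c} : Finset V) → s(x, y) ∉ ({s, a, b, c} : Finset V).sym2 := fun x y hx h =>
      hx (Finset.mk_mem_sym2_iff.1 h).1
    have h0 : ∀ x y : V, x ∉ ({s, a, b, c} : Finset V) → x ≠ y →
        (((fun e' : Sym2 V => if e' ∈ P then w e' else 0) s(x, y) : unitInterval) : ℝ) = 0 := by
      intro x y hx _
      have : s(x, y) ∉ P := fun h => nt x y hx (hPT h)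
      simp [this]
    have h0' : ∀ x y : V, x ∉ ({s, a, b, c} : Finset V) → x ≠ y →
        (((fun e' : Sym2 V => if e' = e then w e' else 0) s(x, y) : unitInterval) : ℝ) = 0 := by
      intro x y hx _
      have : s(x, y) ≠ e := fun h => nt x y hx (h ▸ heT)
      simp [this]
    have h0'' : ∀ x y : V, x ∉ ({s, a, b, c} : Finset V) → x ≠ y →
        (((fun e' : Sym2 V => if e' ∈ insert e P then w e' else 0) s(x, y) : unitInterval) : ℝ) = 0 := by
      intro x y hx _
      have : s(x, y) ∉ insert e P := fun h => nt x y hx (hsub h)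
      simp [this]
    have hmul : ∀ e' : Sym2 V, (1 - (((fun e' : Sym2 V => if e' ∈ insert e P then w e' else 0) e' : unitInterval) : ℝ)) =
        (1 - (((fun e' : Sym2 V => if e' ∈ P then w e' else 0) e' : unitInterval) : ℝ)) *
          (1 - (((fun e' : Sym2 V => if e' = e then w e' else 0) e' : unitInterval) : ℝ)) := by
      intro e'
      by_cases h : e' = e
      · subst h; simp [heP]
      · have : (e' ∈ insert e P) = (e' ∈ P) := by rw [Finset.mem_insert]; simp [h]
        simp [h, this]
    rw [← partLE_blk0 hd, ← partLE_blk1 hd, ← partLE_blk2 hd, ← partLE_blk3 hd, ← partLE_blk4 hd, ← partLE_blk5 hd,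
      ← partLE_blk6 hd, ← partLE_blk7 hd] at G1 C1 G2 C2 ⊢
    rw [← partLE_blk1 hd, ← partLE_blk2 hd, ← partLE_blk4 hd, ← partLE_blk7 hd] at F1 F2
    simp only [real_partLE_terminal_mul _ _ _ _ h0 h0' h0'' hmul]
    exact dvec_p3lam_mul hlam C1 G1 F1 C2 G2 F2

/-- **MAIN THEOREM (graph-level THEOREM C′): for `λ ≥ 8/5`, `P3_λ` on a finite weighted graph follows from `P3_λ` on its `{s,a,b,c}`-pieces.**
Let `s a b c` be pairwise distinct, `part : V → ι` a splitting of `w` along `{s,a,b,c}` (non-terminal pairs across labels have weight `0`), and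
suppose every split component `wᵢ := w·1_{pairs of piece i}` satisfies `μᵢ(F)·μᵢ(c ↔ T) ≤ λ·μᵢ(F ∩ c ↔ T)` (`F = {s↔a}∩{s↮b}`, `T = {s,a,b}`).
Then so does `w`.  In particular, for every `λ ≥ 8/5`, a counterexample to `P3_λ` with the fewest internal vertices is `{s,a,b,c}`-prime.
(THEOREM C is the case `λ = 2`; the conjectured sharp row is `λ = 3/2`, where no such assembly exists at the cell level.) [this work] -/
theorem p3lam_of_pieces {ι : Type*} [Fintype ι] {lam : ℝ} (hlam : 8 / 5 ≤ lam) (w : Sym2 V → unitInterval)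
    (hd : s ≠ a ∧ s ≠ b ∧ s ≠ c ∧ a ≠ b ∧ a ≠ c ∧ b ≠ c) (part : V → ι)
    (hw : ∀ x y : V, x ∉ ({s, a, b, c} : Finset V) → y ∉ ({s, a, b, c} : Finset V) → part x ≠ part y → (w s(x, y) : ℝ) = 0)
    (hrow : ∀ i : ι,
      (prodBernoulli fun e => if e ∈ piecePairs {s, a, b, c} part i then w e else 0).real
          (openConn s a ∩ (openConn s b)ᶜ : Set (BondConfig V)) *
        (prodBernoulli fun e => if e ∈ piecePairs {s, a, b, c} part i then w e else 0).real
          ((openConn c s)ᶜ ∩ (openConn c a)ᶜ ∩ (openConn c b)ᶜ : Set (BondConfig V))ᶜ ≤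
      lam * (prodBernoulli fun e => if e ∈ piecePairs {s, a, b, c} part i then w e else 0).real
          (openConn s a ∩ (openConn s b)ᶜ ∩ ((openConn c s)ᶜ ∩ (openConn c a)ᶜ ∩ (openConn c b)ᶜ)ᶜ : Set (BondConfig V))) :
    (prodBernoulli w).real (openConn s a ∩ (openConn s b)ᶜ : Set (BondConfig V)) *
        (prodBernoulli w).real ((openConn c s)ᶜ ∩ (openConn c a)ᶜ ∩ (openConn c b)ᶜ : Set (BondConfig V))ᶜ ≤
      lam * (prodBernoulli w).real (openConn s a ∩ (openConn s b)ᶜ ∩ ((openConn c s)ᶜ ∩ (openConn c a)ᶜ ∩ (openConn c b)ᶜ)ᶜ : Set (BondConfig V)) := by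
  -- abbreviations: the terminal piece and the pieces
  set w₀ : Sym2 V → unitInterval := fun e => if e ∈ ({s, a, b, c} : Finset V).sym2 then w e else 0 with hw₀
  set wp : ι → Sym2 V → unitInterval := fun i e => if e ∈ piecePairs {s, a, b, c} part i then w e else 0 with hwp
  have G := fun i => (rowLam_iff (wp i) lam s a b c).1 (hrow i)
  have Cp := fun i => core_of_weight (wp i) s a b c
  have Fp := fun i => face_of_weight (wp i) hd
  -- induction over sets of pieces: the vector `D(w₀) · ∏_{i ∈ S} D(wᵢ)` (= `D(w_S)`) satisfies the row
  have key : ∀ S : Finset ι,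
      RowLam[lam;
        (prodBernoulli w₀).real ((openConn s a)ᶜ ∩ (openConn s b)ᶜ ∩ (openConn s c)ᶜ ∩ (openConn a b)ᶜ ∩ (openConn a c)ᶜ ∩ (openConn b c)ᶜ) *
          ∏ i ∈ S, (prodBernoulli (wp i)).real ((openConn s a)ᶜ ∩ (openConn s b)ᶜ ∩ (openConn s c)ᶜ ∩ (openConn a b)ᶜ ∩ (openConn a c)ᶜ ∩ (openConn b c)ᶜ),
        (prodBernoulli w₀).real ((openConn s b)ᶜ ∩ (openConn s c)ᶜ ∩ (openConn a b)ᶜ ∩ (openConn a c)ᶜ ∩ (openConn b c)ᶜ) *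
          ∏ i ∈ S, (prodBernoulli (wp i)).real ((openConn s b)ᶜ ∩ (openConn s c)ᶜ ∩ (openConn a b)ᶜ ∩ (openConn a c)ᶜ ∩ (openConn b c)ᶜ),
        (prodBernoulli w₀).real ((openConn s b)ᶜ ∩ (openConn s c)ᶜ ∩ (openConn a b)ᶜ ∩ (openConn a c)ᶜ) *
          ∏ i ∈ S, (prodBernoulli (wp i)).real ((openConn s b)ᶜ ∩ (openConn s c)ᶜ ∩ (openConn a b)ᶜ ∩ (openConn a c)ᶜ),
        (prodBernoulli w₀).real ((openConn s a)ᶜ ∩ (openConn s b)ᶜ ∩ (openConn s c)ᶜ ∩ (openConn a b)ᶜ ∩ (openConn a c)ᶜ) *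
          ∏ i ∈ S, (prodBernoulli (wp i)).real ((openConn s a)ᶜ ∩ (openConn s b)ᶜ ∩ (openConn s c)ᶜ ∩ (openConn a b)ᶜ ∩ (openConn a c)ᶜ),
        (prodBernoulli w₀).real ((openConn s b)ᶜ ∩ (openConn a b)ᶜ ∩ (openConn b c)ᶜ) *
          ∏ i ∈ S, (prodBernoulli (wp i)).real ((openConn s b)ᶜ ∩ (openConn a b)ᶜ ∩ (openConn b c)ᶜ),
        (prodBernoulli w₀).real ((openConn s a)ᶜ ∩ (openConn s b)ᶜ ∩ (openConn a b)ᶜ ∩ (openConn a c)ᶜ ∩ (openConn b c)ᶜ) *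
          ∏ i ∈ S, (prodBernoulli (wp i)).real ((openConn s a)ᶜ ∩ (openConn s b)ᶜ ∩ (openConn a b)ᶜ ∩ (openConn a c)ᶜ ∩ (openConn b c)ᶜ),
        (prodBernoulli w₀).real ((openConn s a)ᶜ ∩ (openConn s b)ᶜ ∩ (openConn s c)ᶜ ∩ (openConn a b)ᶜ ∩ (openConn b c)ᶜ) *
          ∏ i ∈ S, (prodBernoulli (wp i)).real ((openConn s a)ᶜ ∩ (openConn s b)ᶜ ∩ (openConn s c)ᶜ ∩ (openConn a b)ᶜ ∩ (openConn b c)ᶜ),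
        (prodBernoulli w₀).real ((openConn c s)ᶜ ∩ (openConn c a)ᶜ ∩ (openConn c b)ᶜ) *
          ∏ i ∈ S, (prodBernoulli (wp i)).real ((openConn c s)ᶜ ∩ (openConn c a)ᶜ ∩ (openConn c b)ᶜ)] := by
    intro S
    induction S using Finset.induction_on with
    | empty =>
      simp only [Finset.prod_empty, mul_one]
      exact rowLam_terminal w hd hlam
    | @insert j S hj ih =>
      -- the partial union `w_S` is a weighted graph: order relations and face inequality for `D(w₀)·∏_{i∈S} D(wᵢ)`
      have pu := fun blk : V → ℕ => real_partLE_partialUnion w ({s, a, b, c} : Finset V) part hw S blk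
      have CS := core_of_weight (fun e => if e ∈ ({s, a, b, c} : Finset V).sym2 ∨ ∃ i ∈ S, e ∈ piecePairs {s, a, b, c} part i
        then w e else 0) s a b c
      have FS := face_of_weight (fun e => if e ∈ ({s, a, b, c} : Finset V).sym2 ∨ ∃ i ∈ S, e ∈ piecePairs {s, a, b, c} part i
        then w e else 0) hd
      rw [← partLE_blk0 hd, ← partLE_blk1 hd, ← partLE_blk2 hd, ← partLE_blk3 hd, ← partLE_blk4 hd, ← partLE_blk5 hd,
        ← partLE_blk6 hd, ← partLE_blk7 hd] at CS
      rw [← partLE_blk1 hd, ← partLE_blk2 hd, ← partLE_blk4 hd, ← partLE_blk7 hd] at FS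
      simp only [pu] at CS FS
      rw [partLE_blk0 hd, partLE_blk1 hd, partLE_blk2 hd, partLE_blk3 hd, partLE_blk4 hd, partLE_blk5 hd, partLE_blk6 hd,
        partLE_blk7 hd] at CS
      rw [partLE_blk1 hd, partLE_blk2 hd, partLE_blk4 hd, partLE_blk7 hd] at FS
      have step := dvec_p3lam_mul hlam CS ih FS (Cp j) (G j) (Fp j)
      have r : ∀ (x : ℝ) (y : ι → ℝ), x * ∏ i ∈ insert j S, y i = x * (∏ i ∈ S, y i) * y j := fun x y => by
        rw [Finset.prod_insert hj]; ring
      simp only [r]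
      exact step
  -- at `S = univ` the vector is `D(w)` by the splitting formula
  have K := key Finset.univ
  have S0 := real_partLE_eq_terminalPiece_mul_prod w ({s, a, b, c} : Finset V) part
    (fun v => if v = a then 1 else if v = b then 2 else if v = c then 3 else (0 : ℕ)) hw
  have S1 := real_partLE_eq_terminalPiece_mul_prod w ({s, a, b, c} : Finset V) part
    (fun v => if v = b then 1 else if v = c then 2 else (0 : ℕ)) hw
  have S2 := real_partLE_eq_terminalPiece_mul_prod w ({s, a, b, c} : Finset V) part
    (fun v => if v = b ∨ v = c then 1 else (0 : ℕ)) hw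
  have S3 := real_partLE_eq_terminalPiece_mul_prod w ({s, a, b, c} : Finset V) part
    (fun v => if v = a then 1 else if v = b ∨ v = c then 2 else (0 : ℕ)) hw
  have S4 := real_partLE_eq_terminalPiece_mul_prod w ({s, a, b, c} : Finset V) part
    (fun v => if v = b then 1 else (0 : ℕ)) hw
  have S5 := real_partLE_eq_terminalPiece_mul_prod w ({s, a, b, c} : Finset V) part
    (fun v => if v = a then 1 else if v = b then 2 else (0 : ℕ)) hw
  have S6 := real_partLE_eq_terminalPiece_mul_prod w ({s, a, b, c} : Finset V) part
    (fun v => if v = a ∨ v = c then 1 else if v = b then 2 else (0 : ℕ)) hw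
  have S7 := real_partLE_eq_terminalPiece_mul_prod w ({s, a, b, c} : Finset V) part
    (fun v => if v = c then 1 else (0 : ℕ)) hw
  rw [partLE_blk0 hd] at S0
  rw [partLE_blk1 hd] at S1
  rw [partLE_blk2 hd] at S2
  rw [partLE_blk3 hd] at S3
  rw [partLE_blk4 hd] at S4
  rw [partLE_blk5 hd] at S5
  rw [partLE_blk6 hd] at S6
  rw [partLE_blk7 hd] at S7
  rw [← S0, ← S1, ← S2, ← S3, ← S4, ← S5, ← S6, ← S7] at K
  exact (rowLam_iff w lam s a b c).2 K

/-- **`p3lam_of_pieces` with caller-supplied decidability instances** (e.g. `V = Fin n`, `ι = Fin k` or a type of connected components): the same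
statement, the instances hidden in `{s,a,b,c}` / `piecePairs` being those in scope at the call site. [this work] -/
theorem p3lam_of_pieces' [DecidableEq V] {ι : Type*} [Fintype ι] [DecidableEq ι] {lam : ℝ} (hlam : 8 / 5 ≤ lam)
    (w : Sym2 V → unitInterval) (hd : s ≠ a ∧ s ≠ b ∧ s ≠ c ∧ a ≠ b ∧ a ≠ c ∧ b ≠ c) (part : V → ι)
    (hw : ∀ x y : V, x ∉ ({s, a, b, c} : Finset V) → y ∉ ({s, a, b, c} : Finset V) → part x ≠ part y → (w s(x, y) : ℝ) = 0)
    (hrow : ∀ i : ι,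
      (prodBernoulli fun e => if e ∈ piecePairs {s, a, b, c} part i then w e else 0).real
          (openConn s a ∩ (openConn s b)ᶜ : Set (BondConfig V)) *
        (prodBernoulli fun e => if e ∈ piecePairs {s, a, b, c} part i then w e else 0).real
          ((openConn c s)ᶜ ∩ (openConn c a)ᶜ ∩ (openConn c b)ᶜ : Set (BondConfig V))ᶜ ≤
      lam * (prodBernoulli fun e => if e ∈ piecePairs {s, a, b, c} part i then w e else 0).real
          (openConn s a ∩ (openConn s b)ᶜ ∩ ((openConn c s)ᶜ ∩ (openConn c a)ᶜ ∩ (openConn c b)ᶜ)ᶜ : Set (BondConfig V))) :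
    (prodBernoulli w).real (openConn s a ∩ (openConn s b)ᶜ : Set (BondConfig V)) *
        (prodBernoulli w).real ((openConn c s)ᶜ ∩ (openConn c a)ᶜ ∩ (openConn c b)ᶜ : Set (BondConfig V))ᶜ ≤
      lam * (prodBernoulli w).real (openConn s a ∩ (openConn s b)ᶜ ∩ ((openConn c s)ᶜ ∩ (openConn c a)ᶜ ∩ (openConn c b)ᶜ)ᶜ : Set (BondConfig V)) := by
  obtain rfl : ‹DecidableEq V› = fun a b => Classical.propDecidable (a = b) := Subsingleton.elim _ _
  obtain rfl : ‹DecidableEq ι› = fun a b => Classical.propDecidable (a = b) := Subsingleton.elim _ _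
  exact p3lam_of_pieces hlam w hd part hw hrow

end Pieces

end Summit.CriticalPhenomena.PercolationContinuityZ3.Theorems.SuperTerminalP3LamGluing
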